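import Mathlib
import Literature.Combinatorics.Enumerative.RestrictedInvolutionsMotzkin
import HarnessLib

/-!
# Elementary bounds for the Motzkin numbers: `max(2^{n−1}, F_{n+1}, binom(n,2k) C_k) ≤ M_n ≤ 3^n`

Topic `Combinatorics/Enumerative`; theorems only (no definition, no named fact).  Corollaries of the counts of this
series, all read off inclusions of families counted in the tree:
* `motzkin_le_three_pow`: `M_n ≤ 3^n` — the Motzkin words are words of length `n` over three letters
  (`MotzkinWords.lean`, `card_motzkinWords`);
* `choose_mul_catalan_le_motzkin`: `binom(n, 2k) · C_k ≤ M_n` — the Motzkin words with `k` up steps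
  (`card_motzkinWords_filter_card_support`); in particular `catalan_le_motzkin_two_mul`: `C_k ≤ M_{2k}` (the Dyck words)
  and `motzkin_pos'`;
* `two_pow_le_motzkin`: `2^n ≤ M_{n+1}` — `I_{n+1}(3412, 4321) ⊆ I_{n+1}(3412)` (`card_involutions_av3412_av4321`,
  `card_involutions_av3412`);
* `fib_le_motzkin`: `F_{n+1} ≤ M_n` — `I_n(3412, 321) ⊆ I_n(3412)` (`card_involutions_av3412_av321`).

Sources: the counted families are those of Barnabei–Bonetti–Silimbani 2011 [BarnabeiBonettiSilimbani2011]
(Theorem 8 (v): `|I_n(3412,4321)| = 2^{n−1}`; Corollary 9 (ii): `|I_n(3412,321)| = F_{n+1}`; §5: `|I_n(3412)| = M_n`)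
and Grimaldi 2012, Example 34.1 [Grimaldi2012] ((1) `M_n = Σ_k binom(n,2k) C_k`, (b) Motzkin paths as words over
`{D, D*, R}`); the inequalities themselves are the evident inclusions.
-/

namespace Literature.Combinatorics.Enumerative

open Finset

/-- `M_n ≤ 3^n`: a Motzkin word is a word of length `n` over three letters. [cite: Grimaldi2012, Example 34.1 (b)] -/
theorem motzkin_le_three_pow (n : ℕ) : motzkin n ≤ 3 ^ n := by
  rw [← PermContainsPattern.card_motzkinWords n]
  calc (motzkinWords n).card ≤ (univ : Finset (Fin n → Fin 3)).card := card_le_univ _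
    _ = 3 ^ n := by rw [card_univ, Fintype.card_fun, Fintype.card_fin, Fintype.card_fin]

/-- `binom(n, 2k) · C_k ≤ M_n`: the Motzkin words with exactly `k` up steps. [cite: Grimaldi2012, Example 34.1 (1), (b)] -/
theorem choose_mul_catalan_le_motzkin (n k : ℕ) : n.choose (2 * k) * catalan k ≤ motzkin n := by
  rw [← card_motzkinWords_filter_card_support n k, ← PermContainsPattern.card_motzkinWords n]
  exact card_le_card (filter_subset _ _)

/-- `C_k ≤ M_{2k}`: the Dyck words are the Motzkin words without level steps. [cite: Grimaldi2012, Example 34.1 (1), (b)] -/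
theorem catalan_le_motzkin_two_mul (k : ℕ) : catalan k ≤ motzkin (2 * k) := by
  have := choose_mul_catalan_le_motzkin (2 * k) k
  rwa [Nat.choose_self, one_mul] at this

/-- `2^n ≤ M_{n+1}`: `I_{n+1}(3412, 4321) ⊆ I_{n+1}(3412)`. [cite: BarnabeiBonettiSilimbani2011, Theorem 8 (v) and §5 (arXiv 0812.0463)] -/
theorem two_pow_le_motzkin (n : ℕ) : 2 ^ n ≤ motzkin (n + 1) := by
  rw [← PermContainsPattern.card_involutions_av3412_av4321 n, ← PermContainsPattern.card_involutions_av3412 (n + 1)]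
  exact Nat.card_le_card_of_injective
    (fun u : {u : Equiv.Perm (Fin (n + 1)) // u * u = 1 ∧ ¬ PermContainsPattern u ![3, 4, 1, 2] ∧
      ¬ PermContainsPattern u ![4, 3, 2, 1]} => (⟨u.1, u.2.1, u.2.2.1⟩ :
        {u : Equiv.Perm (Fin (n + 1)) // u * u = 1 ∧ ¬ PermContainsPattern u ![3, 4, 1, 2]}))
    fun a b h => Subtype.ext (by have h1 := Subtype.ext_iff.1 h; exact h1)

/-- `2^{n−1} ≤ M_n` for `n ≥ 1`. [cite: BarnabeiBonettiSilimbani2011, Theorem 8 (v) and §5 (arXiv 0812.0463)] -/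
theorem two_pow_pred_le_motzkin {n : ℕ} (hn : 1 ≤ n) : 2 ^ (n - 1) ≤ motzkin n := by
  obtain ⟨m, rfl⟩ := Nat.exists_eq_add_of_le' hn
  rw [Nat.add_sub_cancel]
  exact two_pow_le_motzkin m

/-- `F_{n+1} ≤ M_n`: `I_n(3412, 321) ⊆ I_n(3412)` (the monomer–dimer tilings among the noncrossing partial matchings).
[cite: BarnabeiBonettiSilimbani2011, Corollary 9 (ii) and §5 (arXiv 0812.0463)] -/
theorem fib_le_motzkin (n : ℕ) : Nat.fib (n + 1) ≤ motzkin n := by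
  rw [← PermContainsPattern.card_involutions_av3412_av321 n, ← PermContainsPattern.card_involutions_av3412 n]
  exact Nat.card_le_card_of_injective
    (fun u : {u : Equiv.Perm (Fin n) // u * u = 1 ∧ ¬ PermContainsPattern u ![3, 4, 1, 2] ∧
      ¬ PermContainsPattern u ![3, 2, 1]} => (⟨u.1, u.2.1, u.2.2.1⟩ :
        {u : Equiv.Perm (Fin n) // u * u = 1 ∧ ¬ PermContainsPattern u ![3, 4, 1, 2]}))
    fun a b h => Subtype.ext (by have h1 := Subtype.ext_iff.1 h; exact h1)

/-- `M_n < M_{n+1}` for `n ≥ 1` (strict growth: `M_{n+1} ≥ M_n + M_{n−1}` and `M_{n−1} ≥ 1`).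
[cite: Bona2023, Ch. 8 Exercise 17 (solution)] -/
theorem motzkin_lt_motzkin_succ {n : ℕ} (hn : 1 ≤ n) : motzkin n < motzkin (n + 1) := by
  obtain ⟨m, rfl⟩ := Nat.exists_eq_add_of_le' hn
  have h1 := motzkin_succ_add_motzkin_le m
  have h2 := motzkin_pos m
  have h3 : m + 1 + 1 = m + 2 := rfl
  rw [h3]
  omega

/-- `n ≤ M_n` (from the strict growth).
[cite: Bona2023, Ch. 8 Exercise 17 (solution)] -/
theorem le_motzkin (n : ℕ) : n ≤ motzkin n := by
  induction n with
  | zero => exact Nat.zero_le _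
  | succ n ih =>
    rcases Nat.eq_zero_or_pos n with rfl | hn
    · simp
    · have := motzkin_lt_motzkin_succ hn
      omega

end Literature.Combinatorics.Enumerative
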